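import Mathlib
import Summits.MatrixMultiplication.MatrixMultiplication.Theorems.SnSubsetDichotomyPolynomialSlackTripleSplit

/-!
# Transferring the level-one pinning to the kept (heavy) term

Crux `Summit.MatrixMultiplication.MatrixMultiplication.Theses.SnSubsetDichotomy.PolynomialSlack`
(item `stmt-MatrixMultiplication-8306`), level-one programme, line transport-split-hull (lead c6,
"beyond one half"). The pinning says `1 - δ ≤ -(n-1)·Σ_{ijk} a_{ij} b_{jk} c_{ki}` for the three centred
quotient profiles. Each profile is split entrywise as `a = pa + la` into a HEAVY part `pa` and a LIGHT
part `la`, with Frobenius bounds `‖pa‖² ≤ E_A` (Parseval type) and `‖la‖² ≤ γ·E_A` (restricted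
level-one inequality, `γ` small), and similarly for `b`, `c`. By `tripleSum_split_le`,
`Σ pa pb pc ≤ Σ a b c + ‖la‖‖b‖‖c‖ + ‖pa‖‖lb‖‖c‖ + ‖pa‖‖pb‖‖lc‖`, and each of the three error
products is at most `√γ · √(E_A E_B E_C)`; multiplying by `n - 1 ≥ 0` and combining with the pinning
gives the pinning for the kept term with the loss `3(n-1)√γ√(E_A E_B E_C)`:

* `kept_ge_of_split` — `1 - δ - 3(n-1)√γ√(E_A E_B E_C) ≤ -(n-1)·Σ_{ijk} pa_{ij} pb_{jk} pc_{ki}`.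
-/

namespace Summit.MatrixMultiplication.MatrixMultiplication.Theorems.PolynomialSlack

open scoped BigOperators

-- `Summit.<Summit>.<Problem>` is the tree's mandated summit-side namespace (CONVENTIONS §2); for
-- this single-conjunct summit the two coincide, so each declaration silences `dupNamespace`.
set_option linter.dupNamespace false

/-- **Pinning of the kept term.** If `a = pa + la`, `b = pb + lb`, `c = pc + lc` entrywise with
`‖b‖², ‖pb‖² ≤ E_B`, `‖c‖² ≤ E_C`, `‖pa‖² ≤ E_A` and `‖la‖² ≤ γE_A`, `‖lb‖² ≤ γE_B`, `‖lc‖² ≤ γE_C`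
(Frobenius norms, `E_A, E_B, E_C, γ ≥ 0`), and `1 - δ ≤ -(n-1)·Σ_{ijk} a_{ij} b_{jk} c_{ki}` with `n ≥ 1`,
then `1 - δ - 3(n-1)√γ√(E_A E_B E_C) ≤ -(n-1)·Σ_{ijk} pa_{ij} pb_{jk} pc_{ki}`: the split bound
`tripleSum_split_le` with each error product bounded by `√γ√(E_A E_B E_C)`. [folklore] -/
theorem kept_ge_of_split {n : ℕ} (a b c pa la pb lb pc lc : Fin n → Fin n → ℝ)
    (ha : ∀ i j, a i j = pa i j + la i j) (hb : ∀ i j, b i j = pb i j + lb i j)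
    (hc : ∀ i j, c i j = pc i j + lc i j) (hn1 : (1 : ℝ) ≤ n) (EA EB EC γ δ : ℝ)
    (hEA : 0 ≤ EA) (hEB : 0 ≤ EB) (hEC : 0 ≤ EC) (hγ : 0 ≤ γ)
    (hb2 : ∑ i : Fin n, ∑ j : Fin n, b i j ^ 2 ≤ EB)
    (hc2 : ∑ i : Fin n, ∑ j : Fin n, c i j ^ 2 ≤ EC)
    (hpa : ∑ i : Fin n, ∑ j : Fin n, pa i j ^ 2 ≤ EA)
    (hpb : ∑ i : Fin n, ∑ j : Fin n, pb i j ^ 2 ≤ EB)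
    (hla : ∑ i : Fin n, ∑ j : Fin n, la i j ^ 2 ≤ γ * EA)
    (hlb : ∑ i : Fin n, ∑ j : Fin n, lb i j ^ 2 ≤ γ * EB)
    (hlc : ∑ i : Fin n, ∑ j : Fin n, lc i j ^ 2 ≤ γ * EC)
    (hpin : 1 - δ ≤ -((n : ℝ) - 1) * ∑ i : Fin n, ∑ j : Fin n, ∑ k : Fin n, a i j * b j k * c k i) :
    1 - δ - 3 * ((n : ℝ) - 1) * Real.sqrt γ * Real.sqrt (EA * EB * EC) ≤
      -((n : ℝ) - 1) * ∑ i : Fin n, ∑ j : Fin n, ∑ k : Fin n, pa i j * pb j k * pc k i := by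
  -- the split bound `Σ pa pb pc ≤ Σ a b c + ‖la‖‖b‖‖c‖ + ‖pa‖‖lb‖‖c‖ + ‖pa‖‖pb‖‖lc‖`
  have hsplit := tripleSum_split_le a b c pa la pb lb pc lc ha hb hc
  -- norm bounds for the seven arrays involved
  have nb : Real.sqrt (∑ i : Fin n, ∑ j : Fin n, b i j ^ 2) ≤ Real.sqrt EB := Real.sqrt_le_sqrt hb2
  have nc : Real.sqrt (∑ i : Fin n, ∑ j : Fin n, c i j ^ 2) ≤ Real.sqrt EC := Real.sqrt_le_sqrt hc2
  have npa : Real.sqrt (∑ i : Fin n, ∑ j : Fin n, pa i j ^ 2) ≤ Real.sqrt EA := Real.sqrt_le_sqrt hpa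
  have npb : Real.sqrt (∑ i : Fin n, ∑ j : Fin n, pb i j ^ 2) ≤ Real.sqrt EB := Real.sqrt_le_sqrt hpb
  have nla : Real.sqrt (∑ i : Fin n, ∑ j : Fin n, la i j ^ 2) ≤ Real.sqrt γ * Real.sqrt EA :=
    (Real.sqrt_le_sqrt hla).trans_eq (Real.sqrt_mul' γ hEA)
  have nlb : Real.sqrt (∑ i : Fin n, ∑ j : Fin n, lb i j ^ 2) ≤ Real.sqrt γ * Real.sqrt EB :=
    (Real.sqrt_le_sqrt hlb).trans_eq (Real.sqrt_mul hγ EB)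
  have nlc : Real.sqrt (∑ i : Fin n, ∑ j : Fin n, lc i j ^ 2) ≤ Real.sqrt γ * Real.sqrt EC :=
    (Real.sqrt_le_sqrt hlc).trans_eq (Real.sqrt_mul hγ EC)
  -- the three error products are each at most `√γ · √E_A √E_B √E_C`
  have e1 : Real.sqrt (∑ i : Fin n, ∑ j : Fin n, la i j ^ 2) * Real.sqrt (∑ i : Fin n, ∑ j : Fin n, b i j ^ 2) *
      Real.sqrt (∑ i : Fin n, ∑ j : Fin n, c i j ^ 2) ≤
        Real.sqrt γ * Real.sqrt EA * Real.sqrt EB * Real.sqrt EC :=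
    mul_le_mul (mul_le_mul nla nb (Real.sqrt_nonneg _) (by positivity)) nc (Real.sqrt_nonneg _)
      (by positivity)
  have e2 : Real.sqrt (∑ i : Fin n, ∑ j : Fin n, pa i j ^ 2) * Real.sqrt (∑ i : Fin n, ∑ j : Fin n, lb i j ^ 2) *
      Real.sqrt (∑ i : Fin n, ∑ j : Fin n, c i j ^ 2) ≤
        Real.sqrt EA * (Real.sqrt γ * Real.sqrt EB) * Real.sqrt EC :=
    mul_le_mul (mul_le_mul npa nlb (Real.sqrt_nonneg _) (Real.sqrt_nonneg _)) nc (Real.sqrt_nonneg _)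
      (by positivity)
  have e3 : Real.sqrt (∑ i : Fin n, ∑ j : Fin n, pa i j ^ 2) * Real.sqrt (∑ i : Fin n, ∑ j : Fin n, pb i j ^ 2) *
      Real.sqrt (∑ i : Fin n, ∑ j : Fin n, lc i j ^ 2) ≤
        Real.sqrt EA * Real.sqrt EB * (Real.sqrt γ * Real.sqrt EC) :=
    mul_le_mul (mul_le_mul npa npb (Real.sqrt_nonneg _) (Real.sqrt_nonneg _)) nlc (Real.sqrt_nonneg _)
      (by positivity)
  -- `√(E_A E_B E_C) = √E_A √E_B √E_C`
  have hX : Real.sqrt (EA * EB * EC) = Real.sqrt EA * Real.sqrt EB * Real.sqrt EC := by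
    rw [Real.sqrt_mul' _ hEC, Real.sqrt_mul' _ hEB]
  -- multiply by `n - 1 ≥ 0` and combine with the pinning
  have hn0 : (0 : ℝ) ≤ (n : ℝ) - 1 := by linarith
  rw [hX]
  linarith [mul_nonneg hn0 (sub_nonneg.mpr hsplit), mul_nonneg hn0 (sub_nonneg.mpr e1),
    mul_nonneg hn0 (sub_nonneg.mpr e2), mul_nonneg hn0 (sub_nonneg.mpr e3), hpin]

end Summit.MatrixMultiplication.MatrixMultiplication.Theorems.PolynomialSlack
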